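import Mathlib
import HarnessLib
import Literature.Topology.FourManifolds.FlowHittingTime
import Summits.NavierStokesRegularity.NavierStokesRegularity.Theorems.PoloidalWindowDoorLrcModEntireRidgeGlobalBranchFrame

/-!
# Item `LrcModEntire` (stmt-NavierStokesRegularity-20428) — BRANCH-PARAM, parts 3–4: the LOCAL analytic arc of the hot set through a non-degenerate hot point, and the local good solution of the hot-branch ODE

LEAD of item 20428 ns-poloidal-K2-p3 g15 (`--supports stmt-NavierStokesRegularity-20428 --as helper`).  Class-free local structure theorem.  Data: an analytic `f : ℝ³ → ℝ`, a
level `M`, the hot set `H = {y₂ = 0, f y = M}` whose points are critical (`Df = 0`), have horizontal Laplacian `−κ ≠ 0` (the ridge law, constant by `…TwistingTHRidgeLaw`) and are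
NOT ISOLATED in `H` (no compact isolated hot piece, clause of `stub_T2b` VERBATIM with `K = {y}`).  A «good» state is a pair `(y, e)` with `y ∈ H`, `e` a horizontal unit vector in the
kernel of `D²f(y)`.

* `exists_local_arc` — through a good `(h, T)` passes an arc `c(a) = h + aT + φ(a)·JT` of `H`, `φ` ANALYTIC with `φ(0) = φ′(0) = 0` (Mathlib's analytic implicit function theorem
  `ContDiffAt.implicitFunction` applied to `∂_{JT} f (h + aT + n·JT) = 0`, whose `n`-derivative at `0` is `D²f(h)[JT,JT] = −κ ≠ 0`; the arc lies in `H` by the identity theorem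
  `AnalyticAt.eventually_eq_zero_or_eventually_ne_zero`, the zeros accumulating at `0` because `h` is not isolated in `H` and every nearby hot point lies on the graph by the
  uniqueness clause of the implicit function theorem); along the arc `D²f(c a)[c′ a, ·] = 0`;
* `exists_local_good_solution` — the arc re-parametrised by arclength (`σ′ = 1/‖c′(σ)‖`, 1-D Picard–Lindelöf) gives `Z = (c∘σ, (c∘σ)′)` SOLVING the hot-branch ODE
  `Z′ = branchField f κ Z` of `…RidgeGlobalBranchODE` near any `s₀` and staying good (jet relations from `D²f(γ)[γ′,·] ≡ 0`, `‖γ′‖² ≡ 1`, `γ′₂ ≡ 0` + `accel_eq_of_jets`).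

WHAT THIS IS NOT: not a claim about Navier–Stokes regularity — a calculus tool for the entrance of research cell (Q4) (bears_on LADDER-NS N0, item 20428 / crux 19708; OPEN).
-/

noncomputable section

-- the summit and its single sub-problem share the name (CONVENTIONS §1), as in every Theorems file
set_option linter.dupNamespace false

namespace Summit.NavierStokesRegularity.NavierStokesRegularity.Theorems.PoloidalWindowDoorLrcModEntireRidgeGlobalBranchLocal

open Set Filter Topology Metric Function
open scoped NNReal InnerProductSpace RealInnerProductSpace ContDiff
open Summit.NavierStokesRegularity.NavierStokesRegularity.Theorems.PoloidalWindowDoorLrcModEntireRidgeGlobalBranchODE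
open Summit.NavierStokesRegularity.NavierStokesRegularity.Theorems.PoloidalWindowDoorLrcModEntireRidgeGlobalBranchFrame

variable {f : EuclideanSpace ℝ (Fin 3) → ℝ} {κ M : ℝ}

/-- **THE LOCAL ARC.**  Through a good state `(h, T)` passes an arc `c` of the hot set with `c 0 = h`, `c′ 0 = T`; on a neighbourhood of `0`: `c` is `C²`, horizontal, hot,
`⟪c′, T⟫ = 1`, and `D²f(c a)[c′ a, ·] = 0`. -/
theorem exists_local_arc (hfa : AnalyticOnNhd ℝ f univ) (hκ : κ ≠ 0)
    (hcrit : ∀ y : EuclideanSpace ℝ (Fin 3), y 2 = 0 → f y = M → fderiv ℝ f y = 0)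
    (htr : ∀ y : EuclideanSpace ℝ (Fin 3), y 2 = 0 → f y = M → fderiv ℝ (fderiv ℝ f) y e0 e0 + fderiv ℝ (fderiv ℝ f) y e1 e1 = -κ)
    (hni : ∀ y : EuclideanSpace ℝ (Fin 3), y 2 = 0 → f y = M → ∀ r > 0,
      ∃ y' : EuclideanSpace ℝ (Fin 3), y' 2 = 0 ∧ f y' = M ∧ y' ≠ y ∧ dist y' y < r)
    {h T : EuclideanSpace ℝ (Fin 3)} (hh2 : h 2 = 0) (hhM : f h = M) (hT2 : T 2 = 0) (hT1 : ‖T‖ = 1)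
    (hker : ∀ w, fderiv ℝ (fderiv ℝ f) h T w = 0) :
    ∃ c : ℝ → EuclideanSpace ℝ (Fin 3), c 0 = h ∧ deriv c 0 = T ∧ ∃ δ > 0, ∀ a, |a| < δ →
      ContDiffAt ℝ 2 c a ∧ (c a) 2 = 0 ∧ f (c a) = M ∧ (deriv c a) 2 = 0 ∧ ⟪deriv c a, T⟫ = 1 ∧
        ∀ w, fderiv ℝ (fderiv ℝ f) (c a) (deriv c a) w = 0 := by
  obtain ⟨hν2, hν1, hTν, hνT⟩ := rotJ_facts hT2 hT1
  set ν := rotJ T with hνdef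
  have hf : ContDiff ℝ ω f := contDiff_iff_contDiffAt.2 fun x => (hfa x (mem_univ x)).contDiffAt
  have hf2 : ContDiff ℝ 2 f := hf.of_le le_top
  -- `D(Df)` everywhere
  have hDf : ∀ x, HasFDerivAt (fderiv ℝ f) (fderiv ℝ (fderiv ℝ f) x) x := fun x =>
    (((hf.fderiv_right (m := 1) le_top).differentiable one_ne_zero) x).hasFDerivAt
  -- the Hessian at `h` in the normal direction
  have hνν : fderiv ℝ (fderiv ℝ f) h ν ν = -κ := by
    have hft := frame_trace (fderiv ℝ (fderiv ℝ f) h) hT2 hT1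
    rw [hker T, htr h hh2 hhM] at hft
    linarith
  -- ### the implicit equation `F(a, n) = ∂_ν f (h + aT + nν) = 0`
  set A : ℝ × ℝ → EuclideanSpace ℝ (Fin 3) := fun q => h + q.1 • T + q.2 • ν with hAdef
  set F : ℝ × ℝ → ℝ := fun q => fderiv ℝ f (A q) ν with hFdef
  have hA0 : A (0, 0) = h := by simp [hAdef]
  have hAan : ∀ q, AnalyticAt ℝ A q := fun q =>
    (analyticAt_const.add ((ContinuousLinearMap.fst ℝ ℝ ℝ).analyticAt q |>.smul analyticAt_const)).add
      ((ContinuousLinearMap.snd ℝ ℝ ℝ).analyticAt q |>.smul analyticAt_const)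
  have hDfν : AnalyticOnNhd ℝ (fun x => fderiv ℝ f x ν) univ := by
    have h1 : AnalyticOnNhd ℝ (fderiv ℝ f) univ := hfa.fderiv
    have h2 := (ContinuousLinearMap.apply ℝ ℝ ν).comp_analyticOnNhd h1
    exact h2
  have hFan : AnalyticAt ℝ F (0, 0) := (hDfν (A (0, 0)) (mem_univ _)).comp (hAan (0, 0))
  have hFω : ContDiffAt ℝ ω F (0, 0) := hFan.contDiffAt
  have hF00 : F (0, 0) = 0 := by
    simp only [hFdef, hA0, hcrit h hh2 hhM, zero_apply]
  -- derivative of `F` at `(0,0)`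
  set Aℓ : ℝ × ℝ →L[ℝ] EuclideanSpace ℝ (Fin 3) :=
    (ContinuousLinearMap.fst ℝ ℝ ℝ).smulRight T + (ContinuousLinearMap.snd ℝ ℝ ℝ).smulRight ν with hAℓ
  have hAd : HasFDerivAt A Aℓ (0, 0) := by
    have h1 : HasFDerivAt (fun q : ℝ × ℝ => q.1 • T) ((ContinuousLinearMap.fst ℝ ℝ ℝ).smulRight T) (0, 0) :=
      (ContinuousLinearMap.fst ℝ ℝ ℝ).hasFDerivAt.smul_const T
    have h2 : HasFDerivAt (fun q : ℝ × ℝ => q.2 • ν) ((ContinuousLinearMap.snd ℝ ℝ ℝ).smulRight ν) (0, 0) :=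
      (ContinuousLinearMap.snd ℝ ℝ ℝ).hasFDerivAt.smul_const ν
    rw [hAdef, hAℓ]
    exact (h1.const_add h).add h2
  have hgν : HasFDerivAt (fun x => fderiv ℝ f x ν)
      ((fderiv ℝ f (A (0, 0))).comp (0 : EuclideanSpace ℝ (Fin 3) →L[ℝ] EuclideanSpace ℝ (Fin 3)) +
        (fderiv ℝ (fderiv ℝ f) (A (0, 0))).flip ν) (A (0, 0)) :=
    (hDf (A (0, 0))).clm_apply (hasFDerivAt_const ν (A (0, 0)))
  have hFd : HasFDerivAt F (((fderiv ℝ f (A (0, 0))).comp (0 : EuclideanSpace ℝ (Fin 3) →L[ℝ] EuclideanSpace ℝ (Fin 3)) +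
        (fderiv ℝ (fderiv ℝ f) (A (0, 0))).flip ν).comp Aℓ) (0, 0) := hgν.comp (0, 0) hAd
  have hinv : (fderiv ℝ F (0, 0) ∘L ContinuousLinearMap.inr ℝ ℝ ℝ).IsInvertible := by
    refine Literature.Topology.FourManifolds.isInvertible_of_apply_one_ne_zero _ ?_
    rw [hFd.fderiv, hA0]
    simp [hAℓ, hνν, hκ]
  -- ### the analytic implicit function `φ`
  have hω0 : (ω : ℕ∞ω) ≠ 0 := by simp
  set φ : ℝ → ℝ := hFω.implicitFunction hω0 hinv with hφdef
  have hφ0 : φ 0 = 0 := by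
    have := hFω.implicitFunction_apply_self hω0 hinv
    simpa using this
  have hφω : ContDiffAt ℝ ω φ 0 := by
    have := hFω.contDiffAt_implicitFunction hω0 hinv
    simpa using this
  have hφan : AnalyticAt ℝ φ 0 := hφω.analyticAt
  have hiff : ∀ᶠ q in 𝓝 ((0 : ℝ), (0 : ℝ)), F q = F (0, 0) ↔ φ q.1 = q.2 :=
    hFω.eventually_apply_eq_iff_implicitFunction hω0 hinv
  have hFφ : ∀ᶠ a in 𝓝 (0 : ℝ), F (a, φ a) = F (0, 0) := by
    have := hFω.eventually_apply_implicitFunction hω0 hinv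
    simpa using this
  -- ### the arc `c`
  set c : ℝ → EuclideanSpace ℝ (Fin 3) := fun a => h + a • T + φ a • ν with hcdef
  have hc0 : c 0 = h := by simp [hcdef, hφ0]
  have hcA : ∀ a, c a = A (a, φ a) := fun a => by simp [hcdef, hAdef]
  have hc2 : ∀ a, c a 2 = 0 := fun a => by simp [hcdef, hh2, hT2, hν2]
  -- hot points near `h` lie on the arc; they accumulate at `h`, so `f ∘ c − M` vanishes FREQUENTLY near `0`
  have hfreq : ∃ᶠ a in 𝓝[≠] (0 : ℝ), f (c a) - M = 0 := by
    rw [Filter.Frequently]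
    intro hev
    obtain ⟨δ₁, hδ₁, hiff'⟩ := Metric.eventually_nhds_iff.1 hiff
    obtain ⟨U, hU, hUev⟩ := eventually_nhdsWithin_iff.1 hev |> Metric.eventually_nhds_iff.1
    obtain ⟨y', hy'2, hy'M, hy'ne, hy'd⟩ := hni h hh2 hhM (min δ₁ U) (lt_min hδ₁ hU)
    set a : ℝ := ⟪y' - h, T⟫ with hadef
    set n : ℝ := ⟪y' - h, ν⟫ with hndef
    have hw2 : (y' - h) 2 = 0 := by simp [hy'2, hh2]
    have hexp : y' - h = a • T + n • ν := horiz_expand hw2 hT2 hT1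
    have hy'eq : y' = h + a • T + n • ν := by rw [add_assoc, ← hexp]; abel
    have hna : |a| ≤ ‖y' - h‖ := by
      have := abs_real_inner_le_norm (y' - h) T; rwa [hT1, mul_one] at this
    have hnn : |n| ≤ ‖y' - h‖ := by
      have := abs_real_inner_le_norm (y' - h) ν; rwa [hν1, mul_one] at this
    have hdist : ‖y' - h‖ < min δ₁ U := by rwa [← dist_eq_norm]
    have hq : dist ((a, n) : ℝ × ℝ) (0, 0) < δ₁ := by
      rw [Prod.dist_eq, Real.dist_eq, Real.dist_eq, sub_zero, sub_zero]
      exact max_lt (hna.trans_lt (hdist.trans_le (min_le_left _ _))) (hnn.trans_lt (hdist.trans_le (min_le_left _ _)))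
    have hFq : F (a, n) = F (0, 0) := by
      rw [hF00]
      simp only [hFdef, hAdef]
      rw [← hy'eq, hcrit y' hy'2 hy'M, zero_apply]
    have hφa : φ a = n := (hiff' hq).1 hFq
    have hca : c a = y' := by rw [hcdef]; simp only; rw [hφa, hy'eq]
    have ha0 : a ≠ 0 := by
      intro ha
      apply hy'ne
      rw [hy'eq, ← hφa, ha, hφ0]; simp
    have haU : dist a 0 < U := by
      rw [Real.dist_eq, sub_zero]; exact hna.trans_lt (hdist.trans_le (min_le_right _ _))
    exact hUev haU ha0 (by rw [hca, hy'M, sub_self])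
  -- the identity theorem: `f ∘ c ≡ M` near `0`
  have hgan : AnalyticAt ℝ (fun a => f (c a) - M) 0 := by
    have hcan : AnalyticAt ℝ c 0 :=
      (analyticAt_const.add (analyticAt_id.smul analyticAt_const)).add (hφan.smul analyticAt_const)
    have h0 : c 0 ∈ (univ : Set (EuclideanSpace ℝ (Fin 3))) := mem_univ _
    exact ((hfa (c 0) h0).comp hcan).sub analyticAt_const
  have hcM : ∀ᶠ a in 𝓝 (0 : ℝ), f (c a) = M := by
    rcases hgan.eventually_eq_zero_or_eventually_ne_zero with hz | hnz
    · exact hz.mono fun a ha => sub_eq_zero.1 ha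
    · exact (hfreq hnz).elim
  -- ### properties of the arc near `0`
  have hφan' : ∀ᶠ a in 𝓝 (0 : ℝ), AnalyticAt ℝ φ a := hφan.eventually_analyticAt
  have hall : ∀ᶠ a in 𝓝 (0 : ℝ), AnalyticAt ℝ φ a ∧ ∀ᶠ b in 𝓝 a, f (c b) = M := hφan'.and hcM.eventually_nhds
  -- at a point `a` where `φ` is analytic and the arc is hot near `a`
  have hlocal : ∀ a, AnalyticAt ℝ φ a → (∀ᶠ b in 𝓝 a, f (c b) = M) →
      ContDiffAt ℝ 2 c a ∧ HasDerivAt c (T + deriv φ a • ν) a ∧ f (c a) = M ∧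
        ∀ w, fderiv ℝ (fderiv ℝ f) (c a) (T + deriv φ a • ν) w = 0 := by
    intro a hφa hhot
    have hcd : ContDiffAt ℝ 2 c a :=
      (contDiffAt_const.add (contDiffAt_id.smul contDiffAt_const)).add ((hφa.contDiffAt.of_le le_top).smul contDiffAt_const)
    have hc' : HasDerivAt c (T + deriv φ a • ν) a := by
      have h1 : HasDerivAt (fun b : ℝ => b • T) ((1 : ℝ) • T) a := (hasDerivAt_id a).smul_const T
      have h2 : HasDerivAt (fun b : ℝ => φ b • ν) (deriv φ a • ν) a := hφa.differentiableAt.hasDerivAt.smul_const ν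
      have := (h1.const_add h).add h2
      rw [one_smul] at this
      rw [hcdef]
      exact this
    have hfca : f (c a) = M := hhot.self_of_nhds
    -- `b ↦ Df(c b)` vanishes near `a`; differentiate
    have hzero : (fun b => fderiv ℝ f (c b)) =ᶠ[𝓝 a] fun _ => (0 : EuclideanSpace ℝ (Fin 3) →L[ℝ] ℝ) :=
      hhot.mono fun b hb => hcrit (c b) (hc2 b) hb
    have hd1 : HasDerivAt (fun b => fderiv ℝ f (c b)) (fderiv ℝ (fderiv ℝ f) (c a) (T + deriv φ a • ν)) a :=
      (hDf (c a)).comp_hasDerivAt a hc'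
    have hd0 : HasDerivAt (fun b => fderiv ℝ f (c b)) (0 : EuclideanSpace ℝ (Fin 3) →L[ℝ] ℝ) a :=
      (hasDerivAt_const a (0 : EuclideanSpace ℝ (Fin 3) →L[ℝ] ℝ)).congr_of_eventuallyEq hzero
    have hD2 : fderiv ℝ (fderiv ℝ f) (c a) (T + deriv φ a • ν) = 0 := hd1.unique hd0
    exact ⟨hcd, hc', hfca, fun w => by rw [hD2, zero_apply]⟩
  -- `φ′(0) = 0`, hence `c′(0) = T`
  have hφ'0 : deriv φ 0 = 0 := by
    obtain ⟨-, -, -, hD2⟩ := hlocal 0 hφan hcM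
    have h := hD2 ν
    rw [hc0, map_add, map_smul, add_apply, smul_apply, hker ν, hνν, smul_eq_mul,
      zero_add] at h
    rcases mul_eq_zero.1 h with h' | h'
    · exact h'
    · exact absurd (neg_eq_zero.1 h') hκ
  have hc'0 : deriv c 0 = T := by
    obtain ⟨-, hc', -, -⟩ := hlocal 0 hφan hcM
    rw [hc'.deriv, hφ'0, zero_smul, add_zero]
  -- ### packaging
  obtain ⟨δ, hδ, hball⟩ := Metric.eventually_nhds_iff.1 hall
  refine ⟨c, hc0, hc'0, δ, hδ, fun a ha => ?_⟩
  have ha' : dist a 0 < δ := by rwa [Real.dist_eq, sub_zero]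
  obtain ⟨hφa, hhot⟩ := hball ha'
  obtain ⟨hcd, hc', hfca, hD2⟩ := hlocal a hφa hhot
  have hderiv : deriv c a = T + deriv φ a • ν := hc'.deriv
  refine ⟨hcd, hc2 a, hfca, ?_, ?_, ?_⟩
  · rw [hderiv]; simp [hT2, hν2]
  · rw [hderiv, inner_add_left, real_inner_smul_left, real_inner_self_eq_norm_sq, hT1, hνT]; ring
  · rw [hderiv]; exact hD2

/-! ### Part 4: the unit-speed local arc SOLVES the hot-branch ODE -/

/-- `∂_a (y ↦ Df(y)[w]) = D²f(y)[a, w]`. -/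
theorem fderiv_fderiv_apply_const {a w y : EuclideanSpace ℝ (Fin 3)} (hd : DifferentiableAt ℝ (fderiv ℝ f) y) :
    fderiv ℝ (fun x => fderiv ℝ f x w) y a = fderiv ℝ (fderiv ℝ f) y a w := by
  rw [fderiv_clm_apply hd (differentiableAt_const w)]
  simp

/-- `D²(y ↦ Df(y)[w])[a, b] = D³f(y)[a, b, w]` for `f` of class `C³`. -/
theorem fderiv_fderiv_fderiv_apply_const (hf : ContDiff ℝ 3 f) (a b w y : EuclideanSpace ℝ (Fin 3)) :
    fderiv ℝ (fderiv ℝ (fun x => fderiv ℝ f x w)) y a b = iteratedFDeriv ℝ 3 f y ![a, b, w] := by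
  have h1 : ContDiff ℝ 2 (fun x => fderiv ℝ f x) := hf.fderiv_right (m := 2) (by norm_cast)
  have h2 : fderiv ℝ (fderiv ℝ (fun x => fderiv ℝ f x w)) y a b = iteratedFDeriv ℝ 2 (fun x => fderiv ℝ f x w) y ![a, b] := by
    rw [iteratedFDeriv_two_apply]; simp
  rw [h2, iteratedFDeriv_clm_apply_const_apply h1 le_rfl]
  conv_rhs => rw [iteratedFDeriv_succ_apply_right]
  have hinit : Fin.init (![a, b, w] : Fin 3 → EuclideanSpace ℝ (Fin 3)) = ![a, b] := by
    funext i; fin_cases i <;> rfl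
  have hlast : (![a, b, w] : Fin 3 → EuclideanSpace ℝ (Fin 3)) (Fin.last 2) = w := rfl
  rw [hinit, hlast]

/-- **LOCAL GOOD SOLUTIONS OF THE HOT-BRANCH ODE.**  Through every good state `(h, T)` and for every initial time `s₀` there is a solution of `Z′ = branchField f κ Z` on a
neighbourhood of `s₀` with `Z s₀ = (h, T)` that stays good (first component hot and horizontal, second component a horizontal unit kernel vector of the Hessian). -/
theorem exists_local_good_solution (hfa : AnalyticOnNhd ℝ f univ) (hκ : κ ≠ 0)
    (hcrit : ∀ y : EuclideanSpace ℝ (Fin 3), y 2 = 0 → f y = M → fderiv ℝ f y = 0)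
    (htr : ∀ y : EuclideanSpace ℝ (Fin 3), y 2 = 0 → f y = M → fderiv ℝ (fderiv ℝ f) y e0 e0 + fderiv ℝ (fderiv ℝ f) y e1 e1 = -κ)
    (hni : ∀ y : EuclideanSpace ℝ (Fin 3), y 2 = 0 → f y = M → ∀ r > 0,
      ∃ y' : EuclideanSpace ℝ (Fin 3), y' 2 = 0 ∧ f y' = M ∧ y' ≠ y ∧ dist y' y < r)
    {h T : EuclideanSpace ℝ (Fin 3)} (hh2 : h 2 = 0) (hhM : f h = M) (hT2 : T 2 = 0) (hT1 : ‖T‖ = 1)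
    (hker : ∀ w, fderiv ℝ (fderiv ℝ f) h T w = 0) (s₀ : ℝ) :
    ∃ ε > 0, ∃ Z : ℝ → EuclideanSpace ℝ (Fin 3) × EuclideanSpace ℝ (Fin 3), Z s₀ = (h, T) ∧
      ∀ s ∈ Ioo (s₀ - ε) (s₀ + ε), HasDerivAt Z (branchField f κ (Z s)) s ∧
        ((Z s).1 2 = 0 ∧ f (Z s).1 = M ∧ (Z s).2 2 = 0 ∧ ‖(Z s).2‖ = 1 ∧ ∀ w, fderiv ℝ (fderiv ℝ f) (Z s).1 (Z s).2 w = 0) := by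
  have hf : ContDiff ℝ ω f := contDiff_iff_contDiffAt.2 fun x => (hfa x (mem_univ x)).contDiffAt
  have hf3 : ContDiff ℝ 3 f := hf.of_le le_top
  have hDf : ∀ x, DifferentiableAt ℝ (fderiv ℝ f) x := fun x =>
    ((hf.fderiv_right (m := 1) le_top).differentiable one_ne_zero) x
  -- the scalar fields `g_w = Df(·)[w]` and their derivatives
  have hg : ∀ w : EuclideanSpace ℝ (Fin 3), ContDiff ℝ ω (fun x => fderiv ℝ f x w) := fun w =>
    (hf.fderiv_right (m := ω) le_top).clm_apply contDiff_const
  have hk1 : ∀ w x, HasFDerivAt (fun x => fderiv ℝ f x w) (fderiv ℝ (fun x => fderiv ℝ f x w) x) x := fun w x =>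
    (((hg w).differentiable (by simp)) x).hasFDerivAt
  have hk2 : ∀ w x, HasFDerivAt (fderiv ℝ (fun x => fderiv ℝ f x w)) (fderiv ℝ (fderiv ℝ (fun x => fderiv ℝ f x w)) x) x :=
    fun w x => ((((hg w).fderiv_right (m := 1) le_top).differentiable one_ne_zero) x).hasFDerivAt
  have hsymm : ∀ x, fderiv ℝ (fderiv ℝ f) x e0 e1 = fderiv ℝ (fderiv ℝ f) x e1 e0 := fun x =>
    (hf.contDiffAt (x := x)).isSymmSndFDerivAt (by simp) e0 e1
  obtain ⟨c, hc0, hc'0, δ, hδ, hc⟩ := exists_local_arc hfa hκ hcrit htr hni hh2 hhM hT2 hT1 hker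
  -- the speed never vanishes on the arc
  have hne : ∀ a, |a| < δ → ‖deriv c a‖ ≠ 0 := by
    intro a ha h0
    have h1 := (hc a ha).2.2.2.2.1
    rw [norm_eq_zero.1 h0, inner_zero_left] at h1
    exact zero_ne_one h1
  -- smoothness of the speed and of the unit tangent along the arc
  have hd1 : ∀ a, |a| < δ → ContDiffAt ℝ 1 (deriv c) a := by
    intro a ha
    have h := ((hc a ha).1.fderiv_right (m := 1) (by norm_num)).clm_apply contDiffAt_const (g := fun _ => (1 : ℝ))
    have heq : (fun b => fderiv ℝ c b 1) = deriv c := by funext b; exact fderiv_apply_one_eq_deriv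
    rw [← heq]; exact h
  have hGd : ∀ a, |a| < δ → ContDiffAt ℝ 1 (fun b => ‖deriv c b‖⁻¹) a := fun a ha =>
    ((hd1 a ha).norm ℝ (norm_ne_zero_iff.1 (hne a ha))).inv (hne a ha)
  have hnd : ∀ a, |a| < δ → DifferentiableAt ℝ (fun b => ‖deriv c b‖⁻¹ • deriv c b) a := fun a ha =>
    ((hGd a ha).differentiableAt one_ne_zero).smul ((hd1 a ha).differentiableAt one_ne_zero)
  -- ### arclength: `σ′ = 1/‖c′(σ)‖`, `σ(s₀) = 0`
  have hδ0 : |(0 : ℝ)| < δ := by simpa using hδ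
  obtain ⟨r, hr, ε, hε, hsol⟩ := (hGd 0 hδ0).exists_forall_mem_closedBall_exists_eq_forall_mem_Ioo_hasDerivAt s₀
  obtain ⟨σ, hσ0, hσ'⟩ := hsol 0 (mem_closedBall_self hr.le)
  have hσc : ContinuousAt σ s₀ := (hσ' s₀ ⟨by linarith, by linarith⟩).continuousAt
  have hsmall : ∀ᶠ s in 𝓝 s₀, |σ s| < δ := by
    have hmem : Ioo (-δ) δ ∈ 𝓝 (σ s₀) := by rw [hσ0]; exact Ioo_mem_nhds (by linarith) hδ
    filter_upwards [hσc.preimage_mem_nhds hmem] with s hs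
    exact abs_lt.2 hs
  obtain ⟨ε₁, hε₁, hball⟩ := Metric.eventually_nhds_iff.1 hsmall
  -- ### the candidate solution
  set U : ℝ → EuclideanSpace ℝ (Fin 3) := fun t => ‖deriv c (σ t)‖⁻¹ • deriv c (σ t) with hUdef
  set Z : ℝ → EuclideanSpace ℝ (Fin 3) × EuclideanSpace ℝ (Fin 3) := fun t => (c (σ t), U t) with hZdef
  have hJ : ∀ t ∈ Ioo (s₀ - min ε ε₁) (s₀ + min ε ε₁), t ∈ Ioo (s₀ - ε) (s₀ + ε) ∧ |σ t| < δ := by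
    intro t ht
    refine ⟨⟨by linarith [ht.1, min_le_left ε ε₁], by linarith [ht.2, min_le_left ε ε₁]⟩, hball ?_⟩
    rw [Real.dist_eq, abs_lt]
    constructor <;> linarith [ht.1, ht.2, min_le_right ε ε₁]
  -- pointwise facts along the solution
  have hpt : ∀ t ∈ Ioo (s₀ - min ε ε₁) (s₀ + min ε ε₁),
      ‖U t‖ = 1 ∧ U t 2 = 0 ∧ (c (σ t)) 2 = 0 ∧ f (c (σ t)) = M ∧ fderiv ℝ (fderiv ℝ f) (c (σ t)) (U t) = 0 := by
    intro t ht
    obtain ⟨-, hσδ⟩ := hJ t ht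
    obtain ⟨-, hca2, hcaM, hc'a2, -, hD2a⟩ := hc (σ t) hσδ
    refine ⟨?_, ?_, hca2, hcaM, ?_⟩
    · rw [hUdef]; simp only
      rw [norm_smul, norm_inv, norm_norm, inv_mul_cancel₀ (hne _ hσδ)]
    · simp [hUdef, hc'a2]
    · ext w
      rw [hUdef]; simp only
      rw [map_smul, smul_apply, hD2a w, smul_zero, zero_apply]
  refine ⟨min ε ε₁, lt_min hε hε₁, Z, ?_, fun s hs => ?_⟩
  · simp only [hZdef, hUdef, hσ0, hc0, hc'0, hT1, inv_one, one_smul]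
  obtain ⟨hsε, hsδ⟩ := hJ s hs
  obtain ⟨hun, hu2, hca2, hcaM, hkerU⟩ := hpt s hs
  obtain ⟨hcd, -, -, -, -, -⟩ := hc (σ s) hsδ
  have hkerU' : ∀ w, fderiv ℝ (fderiv ℝ f) (c (σ s)) (U s) w = 0 := fun w => by rw [hkerU, zero_apply]
  -- ### derivatives at `s`
  have hσs : HasDerivAt σ (‖deriv c (σ s)‖⁻¹) s := hσ' s hsε
  have hca' : HasDerivAt c (deriv c (σ s)) (σ s) := (hcd.differentiableAt (by norm_num)).hasDerivAt
  have hγ : HasDerivAt (fun t => c (σ t)) (U s) s := hca'.scomp s hσs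
  have hU : HasDerivAt U (‖deriv c (σ s)‖⁻¹ • deriv (fun b => ‖deriv c b‖⁻¹ • deriv c b) (σ s)) s :=
    (hnd (σ s) hsδ).hasDerivAt.scomp s hσs
  set u' := ‖deriv c (σ s)‖⁻¹ • deriv (fun b => ‖deriv c b‖⁻¹ • deriv c b) (σ s) with hu'def
  -- facts holding on a neighbourhood of `s`
  have hnb : ∀ᶠ t in 𝓝 s, t ∈ Ioo (s₀ - min ε ε₁) (s₀ + min ε ε₁) := Ioo_mem_nhds hs.1 hs.2
  -- (i) differentiate `D²f(γ)[U, w] ≡ 0` for each fixed `w` (scalar chain through `g_w = Df(·)[w]`)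
  have hq : ∀ w, fderiv ℝ (fderiv ℝ (fderiv ℝ f)) (c (σ s)) (U s) (U s) w + fderiv ℝ (fderiv ℝ f) (c (σ s)) u' w = 0 := by
    intro w
    have hB : HasDerivAt (fun t => fderiv ℝ (fun x => fderiv ℝ f x w) (c (σ t)))
        (fderiv ℝ (fderiv ℝ (fun x => fderiv ℝ f x w)) (c (σ s)) (U s)) s := (hk2 w (c (σ s))).comp_hasDerivAt s hγ
    have hΦ := hB.clm_apply hU
    have hzero : ∀ t ∈ Ioo (s₀ - min ε ε₁) (s₀ + min ε ε₁), fderiv ℝ (fun x => fderiv ℝ f x w) (c (σ t)) (U t) = 0 := by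
      intro t ht
      rw [fderiv_fderiv_apply_const (hDf _), (hpt t ht).2.2.2.2, zero_apply]
    have hΦ0 : HasDerivAt (fun t => fderiv ℝ (fun x => fderiv ℝ f x w) (c (σ t)) (U t)) (0 : ℝ) s :=
      (hasDerivAt_const s (0 : ℝ)).congr_of_eventuallyEq (hnb.mono fun t ht => hzero t ht)
    have heq := hΦ.unique hΦ0
    rw [fderiv_fderiv_fderiv_apply_const hf3, fderiv_fderiv_apply_const (hDf _)] at heq
    rw [fderiv3_eq_iteratedFDeriv hf3]
    exact heq
  -- (ii) differentiate `‖U‖² ≡ 1`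
  have horth : ⟪U s, u'⟫ = 0 := by
    have h1 : HasDerivAt (fun t => ‖U t‖ ^ 2) (2 * ⟪U s, u'⟫) s := hU.norm_sq
    have h0 : HasDerivAt (fun t => ‖U t‖ ^ 2) 0 s :=
      (hasDerivAt_const s (1 : ℝ)).congr_of_eventuallyEq (hnb.mono fun t ht => by simp [(hpt t ht).1])
    have := h1.unique h0
    linarith
  -- (iii) differentiate `U₂ ≡ 0`
  have hu'2 : u' 2 = 0 := by
    have h1 : HasDerivAt (fun t => U t 2) (u' 2) s :=
      (EuclideanSpace.proj (2 : Fin 3) : EuclideanSpace ℝ (Fin 3) →L[ℝ] ℝ).hasFDerivAt.comp_hasDerivAt s hU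
    have h0 : HasDerivAt (fun t => U t 2) 0 s :=
      (hasDerivAt_const s (0 : ℝ)).congr_of_eventuallyEq (hnb.mono fun t ht => (hpt t ht).2.1)
    exact h1.unique h0
  -- ### the acceleration identity ⇒ `U′ = accel`
  have hacc := accel_eq_of_jets (fderiv ℝ (fderiv ℝ f) (c (σ s))) hu2 hun hu'2 horth hκ (hsymm _) hkerU'
    (htr _ hca2 hcaM) (fderiv ℝ (fderiv ℝ (fderiv ℝ f)) (c (σ s)) (U s) (U s)) hq
  have hval : branchField f κ (Z s) = (U s, u') := by
    refine Prod.ext ?_ ?_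
    · simp [hZdef, clip_of_norm_eq_one hun]
    · rw [branchField_snd, hacc]
      simp only [hZdef, accel, D3n_eq_fderiv3 hf3 hun, ← fderiv_fderiv_eq_D2c]
  refine ⟨?_, hca2, hcaM, hu2, hun, hkerU'⟩
  rw [hval]
  exact hγ.prodMk hU

end Summit.NavierStokesRegularity.NavierStokesRegularity.Theorems.PoloidalWindowDoorLrcModEntireRidgeGlobalBranchLocal

end
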